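import Mathlib.RingTheory.Polynomial.GaussNorm
import Mathlib.RingTheory.Valuation.ExtendToLocalization
import Mathlib.FieldTheory.RatFunc.AsPolynomial
import Mathlib.Analysis.Normed.Unbundled.RingSeminorm
import Mathlib.Analysis.Normed.Unbundled.SpectralNorm
import Mathlib.Analysis.Normed.Field.WithAbs
import Mathlib.Analysis.Normed.Field.Instances
import Mathlib.Analysis.Normed.Field.Dense
import Mathlib.Analysis.Normed.Group.Ultra
import Mathlib.Analysis.Normed.Group.Completion
import Mathlib.Analysis.Normed.Module.Completion
import Mathlib.Analysis.Normed.Algebra.Ultra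
import Summits.ABC.IUTFork.Joshi.ArithTeichmullerSpace
import HarnessLib

/-!
# A GAUSS UNTILT: a second inhabitant of E-t1's `Untilt p`, built from the Gauss norm on `ℚ_p(T)`

Proof-and-construction companion (abc-iut cell, branch E, rung LADDER-ABC:A2.E; seat abc-iut-E-t55 g3, [J-I] §3/§7
lineage) over E-t1's carrier file `Joshi/ArithTeichmullerSpace.lean` (p428170: `Untilt p`, `Untilt.TopIso`,
`Untilt.padicComplex`). Mathlib only; nothing of E-t1's is restated or edited; no `Prop` claim, no fact, no sorry.

WHY. Every untilt the tree exhibits so far is `ℂ_p` with its norm raised to a power (`Untilt.padicComplex`,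
`Untilt.rescaled`, the signatures `threePoint`, `frobLine`) — all topologically isomorphic to `ℂ_p`: E-t1's predicate
`Untilt.TopIso` was never seen to FAIL in the kernel, and the hypothesis of E-t17's `ATS1.thm743NonIso_of_not_topIso`
([J-I] Thm. 7.4.3 (1)) and E-t1's `UntiltPoints.ExistsNonIsomorphic` / `ActionChangesTopology` were inhabited nowhere.
This file builds an untilt the kernel CAN separate from `ℂ_p` (separation + consequences: `Joshi/UntiltGaussNonIso.lean`).

CONSTRUCTION (Mathlib's `ℚ_[p] ↦ PadicAlgCl p ↦ ℂ_[p]` one storey lower): (1) the Gauss absolute value of radius `r > 0`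
on `ℚ_p[X]`, `|Σ aᵢXⁱ| = maxᵢ |aᵢ|_p rⁱ` (`Polynomial.gaussNorm`, multiplicative by `Polynomial.gaussNorm_mul`), as a
`Valuation`, extended to `ℚ_p(X)` (`Valuation.extendToLocalization`), repackaged as an `AbsoluteValue` (`gaussAbs`);
(2) `GFun := WithAbs gaussAbs` and its completion `GFunHat` (complete, ultrametric, char. `0`, `‖p‖ = p⁻¹`, `‖X‖ = r`);
(3) `GAlgCl := AlgebraicClosure GFunHat` with the spectral norm (`spectralNorm.normedField`); (4) `GField :=`
its completion, algebraically closed by `IsAlgClosed.of_denseRange` ⇒ **`Untilt.gauss p r hr : Untilt p`** with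
`‖p‖ = p⁻¹` and an element `gaussT` of norm `r`; (5) the preferred `algClGauss : Q̄_p →+* GField`, ISOMETRIC for the
`p`-adic norm of `Q̄_p` (`norm_algClGauss`, by `spectralNorm_unique`) and continuous.

FAITHFULNESS CAVEAT (for the referee lanes; no side taken). K. Joshi, arXiv 2106.11452 **v4** (UNREFEREED; typed AS A
CANDIDATE, D-0012): §3.6 p.10 l.10–13 «such fields `K ↩ E` exist and are parametrized by Fargues–Fontaine curves …
Without further mention, all untilts `K` will be assumed to be of this type (for our chosen `p`-adic field `E`)», §3.7
p.10 l.14–17 «there exist untilts of `ℂ_p^♭` which are not topologically isomorphic. This is the main result of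
[Kedlaya and Temkin, 2018, Theorem 1.3]», Prop. 4.1.7 (1) p.19 l.22–28 «`K₁`, `K₂` have … the same residue fields and
the same value groups as that of `F`». E-t1's `Untilt p` records NO tilt («the tilt is not recorded here»), so `𝔾`
is an untilt IN THE TYPED SENSE ONLY: its value group contains `r` (take `r = p^√2 ∉ p^ℚ`), so by Prop. 4.1.7 (1) it
is NOT an untilt of `ℂ_p^♭`; nothing here is [KedlayaTemkin2018] or Joshi's same-tilt mechanism. What the two files
settle is the TYPED sentences (`TopIso` non-trivial on the typed carrier; Thm. 7.4.3 (1) AS TYPED hypothesis-free),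
and they CALIBRATE the carrier: the typed predicates are weaker than print exactly by the unrecorded tilt.
Typed ≠ proved ≠ endorsed; no side taken on [IUTchIII] Cor. 3.12 or on any author. bears_on: LADDER-ABC:A2.E.
-/

noncomputable section

open Polynomial NNReal

namespace Summit.ABC.IUTFork.Joshi.GaussUntilt

variable (p : ℕ) [Fact p.Prime]

/-! ## 1. The Gauss absolute value on `ℚ_p(X)` -/

/-- The `p`-adic absolute value of `ℚ_p`, real-valued (Mathlib's norm as an `AbsoluteValue`). [folklore] -/
def padicAbs : AbsoluteValue ℚ_[p] ℝ := NormedField.toAbsoluteValue ℚ_[p]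

/-- `padicAbs x = ‖x‖`. [folklore] -/
theorem padicAbs_apply (x : ℚ_[p]) : padicAbs p x = ‖x‖ := rfl
/-- The `p`-adic absolute value is nonarchimedean. [folklore] -/
theorem isNonarchimedean_padicAbs : IsNonarchimedean (padicAbs p) :=
  IsUltrametricDist.isNonarchimedean_norm

variable (r : ℝ)

/-- **The Gauss valuation** of radius `r` on `ℚ_p[X]`: `f ↦ max_i |a_i|_p · rⁱ`, multiplicative (Mathlib
`Polynomial.gaussNorm_mul`) and ultrametric (`Polynomial.isNonarchimedean_gaussNorm`), valued in `ℝ≥0`. [folklore] -/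
def gaussVal (hr : 0 < r) : Valuation ℚ_[p][X] ℝ≥0 where
  toFun f := ⟨f.gaussNorm (padicAbs p) r, Polynomial.gaussNorm_nonneg (padicAbs p) f hr.le⟩
  map_zero' := NNReal.eq <| by
    show (0 : ℚ_[p][X]).gaussNorm (padicAbs p) r = 0
    simp
  map_one' := NNReal.eq <| by
    show (1 : ℚ_[p][X]).gaussNorm (padicAbs p) r = 1
    rw [show (1 : ℚ_[p][X]) = C 1 from rfl, Polynomial.gaussNorm_C]; simp
  map_mul' f g := NNReal.eq <| by
    show (f * g).gaussNorm (padicAbs p) r = f.gaussNorm (padicAbs p) r * g.gaussNorm (padicAbs p) r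
    exact Polynomial.gaussNorm_mul (isNonarchimedean_padicAbs p) hr f g
  map_add_le_max' f g :=
    Polynomial.isNonarchimedean_gaussNorm (padicAbs p) (isNonarchimedean_padicAbs p) hr.le f g

/-- `gaussVal f = gaussNorm f` as reals. [folklore] -/
theorem coe_gaussVal (hr : 0 < r) (f : ℚ_[p][X]) : (gaussVal p r hr f : ℝ) = f.gaussNorm (padicAbs p) r := rfl

/-- The Gauss valuation has trivial support, so it extends to the fraction field. [folklore] -/
theorem gaussVal_supp_le (hr : 0 < r) : nonZeroDivisors ℚ_[p][X] ≤ (gaussVal p r hr).supp.primeCompl := by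
  intro f hf
  have hf0 : f ≠ 0 := nonZeroDivisors.ne_zero hf
  show f ∉ (gaussVal p r hr).supp
  rw [Valuation.mem_supp_iff]
  intro h
  apply hf0
  have h' : f.gaussNorm (padicAbs p) r = 0 := by
    rw [← coe_gaussVal p r hr f, h]; rfl
  exact (Polynomial.gaussNorm_eq_zero_iff (padicAbs p) f
    (fun x hx => by simpa [padicAbs_apply] using hx) hr).mp h'

/-- The Gauss valuation on the rational function field `ℚ_p(X)`. [folklore] -/
def gaussValRat (hr : 0 < r) : Valuation (RatFunc ℚ_[p]) ℝ≥0 :=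
  (gaussVal p r hr).extendToLocalization (gaussVal_supp_le p r hr) (RatFunc ℚ_[p])

/-- **The Gauss absolute value** of radius `r` on `ℚ_p(X)`. [folklore] -/
def gaussAbs (hr : 0 < r) : AbsoluteValue (RatFunc ℚ_[p]) ℝ where
  toFun f := (gaussValRat p r hr f : ℝ)
  map_mul' f g := by simp
  nonneg' _ := NNReal.coe_nonneg _
  eq_zero' f := by simp
  add_le' f g := by
    have h := (gaussValRat p r hr).map_add f g
    calc ((gaussValRat p r hr (f + g) : ℝ≥0) : ℝ)
        ≤ max (gaussValRat p r hr f : ℝ) (gaussValRat p r hr g : ℝ) := by exact_mod_cast h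
      _ ≤ _ := max_le_add_of_nonneg (NNReal.coe_nonneg _) (NNReal.coe_nonneg _)

/-- Unfolding `gaussAbs`. [folklore] -/
theorem gaussAbs_apply (hr : 0 < r) (f : RatFunc ℚ_[p]) : gaussAbs p r hr f = (gaussValRat p r hr f : ℝ) := rfl

/-- The Gauss absolute value is nonarchimedean. [folklore] -/
theorem isNonarchimedean_gaussAbs (hr : 0 < r) : IsNonarchimedean (gaussAbs p r hr) := fun f g => by
  rw [gaussAbs_apply, gaussAbs_apply, gaussAbs_apply]; exact_mod_cast (gaussValRat p r hr).map_add f g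

/-- On polynomials the Gauss absolute value is the Gauss norm. [folklore] -/
theorem gaussAbs_algebraMap (hr : 0 < r) (f : ℚ_[p][X]) :
    gaussAbs p r hr (algebraMap ℚ_[p][X] (RatFunc ℚ_[p]) f) = f.gaussNorm (padicAbs p) r := by
  rw [gaussAbs_apply, gaussValRat, Valuation.extendToLocalization_apply_map_apply, coe_gaussVal]

/-- On constants the Gauss absolute value is `|·|_p`. [folklore] -/
theorem gaussAbs_C (hr : 0 < r) (x : ℚ_[p]) :
    gaussAbs p r hr (algebraMap ℚ_[p] (RatFunc ℚ_[p]) x) = ‖x‖ := by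
  rw [RatFunc.algebraMap_apply, map_one, div_one, Polynomial.algebraMap_eq, gaussAbs_algebraMap,
    Polynomial.gaussNorm_C]
  rfl

/-- `|X| = r`. [folklore] -/
theorem gaussAbs_X (hr : 0 < r) : gaussAbs p r hr (algebraMap ℚ_[p][X] (RatFunc ℚ_[p]) X) = r := by
  rw [gaussAbs_algebraMap, ← Polynomial.monomial_one_one_eq_X, Polynomial.gaussNorm_monomial]
  simp

/-- `|n| = |n|_p` for natural numbers `n`. [folklore] -/
theorem gaussAbs_natCast (hr : 0 < r) (n : ℕ) : gaussAbs p r hr (n : RatFunc ℚ_[p]) = ‖(n : ℚ_[p])‖ := by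
  rw [← map_natCast (algebraMap ℚ_[p] (RatFunc ℚ_[p])) n, gaussAbs_C]

/-- `ℚ_p(X)` has characteristic zero. [folklore] -/
instance : CharZero (RatFunc ℚ_[p]) :=
  (RingHom.charZero_iff (algebraMap ℚ_[p] (RatFunc ℚ_[p])).injective).mp inferInstance

/-! ## 2. `ℚ_p(X)` normed by the Gauss absolute value, and its completion -/

variable (hr : 0 < r)

/-- `ℚ_p(X)` as a normed field for the Gauss absolute value of radius `r` (Mathlib `WithAbs`). [folklore] -/
abbrev GFun : Type := WithAbs (gaussAbs p r hr)

/-- The completion of `(ℚ_p(X), |·|_{Gauss,r})` (Mathlib `AbsoluteValue.Completion`): a complete normed field. [folklore] -/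
abbrev GFunHat : Type := (gaussAbs p r hr).Completion

/-- `GFun` has characteristic zero. [folklore] -/
instance : CharZero (GFun p r hr) :=
  (RingHom.charZero_iff (ϕ := (WithAbs.equiv (gaussAbs p r hr)).symm.toRingHom)
    (WithAbs.equiv (gaussAbs p r hr)).symm.injective).mp inferInstance

/-- `GFun` is ultrametric. [folklore] -/
instance : IsUltrametricDist (GFun p r hr) :=
  IsUltrametricDist.isUltrametricDist_of_isNonarchimedean_norm fun x y => by
    simpa only [WithAbs.norm_eq_apply_ofAbs, WithAbs.ofAbs_add] using
      isNonarchimedean_gaussAbs p r hr x.ofAbs y.ofAbs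

/-- Completions of ultrametric normed fields are ultrametric (closed condition, dense range). [folklore] -/
theorem isUltrametricDist_completion (A : Type) [NormedField A] [IsUltrametricDist A] :
    IsUltrametricDist (UniformSpace.Completion A) := by
  constructor
  intro x y z
  refine UniformSpace.Completion.induction_on₃ x y z ?_ ?_
  · exact isClosed_le (by fun_prop) (by fun_prop)
  · intro a b c
    rw [UniformSpace.Completion.dist_eq, UniformSpace.Completion.dist_eq, UniformSpace.Completion.dist_eq]
    exact dist_triangle_max a b c

/-- `GFunHat` is ultrametric. [folklore] -/
instance : IsUltrametricDist (GFunHat p r hr) := isUltrametricDist_completion (GFun p r hr)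

/-- `GFunHat` has characteristic zero. [folklore] -/
instance : CharZero (GFunHat p r hr) :=
  (RingHom.charZero_iff (algebraMap (GFun p r hr) (GFunHat p r hr)).injective).mp inferInstance

/-- The completion map preserves norms. [folklore] -/
theorem norm_coe_GFunHat (f : GFun p r hr) : ‖(f : GFunHat p r hr)‖ = ‖f‖ := UniformSpace.Completion.norm_coe f

/-- `algebraMap GFun GFunHat` is the completion map. [folklore] -/
theorem algebraMap_GFunHat_eq (f : GFun p r hr) :
    algebraMap (GFun p r hr) (GFunHat p r hr) f = (f : GFunHat p r hr) := rfl

/-- `‖n‖ = |n|_p` in `GFunHat`. [folklore] -/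
theorem norm_natCast_GFunHat (n : ℕ) : ‖(n : GFunHat p r hr)‖ = ‖(n : ℚ_[p])‖ := by
  rw [← map_natCast (algebraMap (GFun p r hr) (GFunHat p r hr)) n, algebraMap_GFunHat_eq, norm_coe_GFunHat,
    WithAbs.norm_eq_apply_ofAbs]
  have : ((n : GFun p r hr)).ofAbs = (n : RatFunc ℚ_[p]) := map_natCast (WithAbs.equiv (gaussAbs p r hr)) n
  rw [this, gaussAbs_natCast]

/-- `GFunHat` is nontrivially normed (`‖p⁻¹‖ = p > 1`). [folklore] -/
instance : NontriviallyNormedField (GFunHat p r hr) where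
  non_trivial := ⟨((p : GFunHat p r hr))⁻¹, by
    rw [norm_inv, norm_natCast_GFunHat, Padic.norm_p]
    simp only [inv_inv, Nat.one_lt_cast]
    exact (Fact.out : p.Prime).one_lt⟩

/-- `ℚ_p ⊆ GFun` is isometric. [folklore] -/
theorem norm_algebraMap_GFun (x : ℚ_[p]) : ‖algebraMap ℚ_[p] (GFun p r hr) x‖ = ‖x‖ := by
  show ‖WithAbs.toAbs (gaussAbs p r hr) (algebraMap ℚ_[p] (RatFunc ℚ_[p]) x)‖ = ‖x‖
  rw [WithAbs.norm_toAbs_eq, gaussAbs_C]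

/-- `ℚ_p ⊆ GFunHat` is isometric. [folklore] -/
theorem norm_algebraMap_GFunHat (x : ℚ_[p]) : ‖algebraMap ℚ_[p] (GFunHat p r hr) x‖ = ‖x‖ := by
  rw [IsScalarTower.algebraMap_apply ℚ_[p] (GFun p r hr) (GFunHat p r hr), algebraMap_GFunHat_eq, norm_coe_GFunHat,
    norm_algebraMap_GFun]

/-! ## 3. The algebraic closure with the spectral norm -/

/-- A fixed algebraic closure of `GFunHat`. [folklore] -/
abbrev GAlgCl : Type := AlgebraicClosure (GFunHat p r hr)

/-- `GAlgCl` is algebraic over `GFunHat`. [folklore] -/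
instance : Algebra.IsAlgebraic (GFunHat p r hr) (GAlgCl p r hr) := AlgebraicClosure.isAlgebraic _

/-- `GAlgCl` normed by the SPECTRAL NORM (the unique extension of the complete field `GFunHat`'s norm; Mathlib
`spectralNorm.normedField`, as for `PadicAlgCl`). [folklore] -/
instance instNormedFieldGAlgCl : NormedField (GAlgCl p r hr) :=
  spectralNorm.normedField (GFunHat p r hr) (GAlgCl p r hr)

/-- … a normed `GFunHat`-algebra. [folklore] -/
instance : NormedAlgebra (GFunHat p r hr) (GAlgCl p r hr) := spectralNorm.normedAlgebra (GFunHat p r hr) (GAlgCl p r hr)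

/-- `GFunHat ⊆ GAlgCl` is isometric. [folklore] -/
theorem norm_algebraMap_GAlgCl (x : GFunHat p r hr) : ‖algebraMap (GFunHat p r hr) (GAlgCl p r hr) x‖ = ‖x‖ :=
  spectralNorm_extends x

/-- `GAlgCl` is ultrametric (a normed algebra over an ultrametric field). [folklore] -/
instance : IsUltrametricDist (GAlgCl p r hr) := IsUltrametricDist.of_normedAlgebra (GFunHat p r hr)

/-- `GAlgCl` has characteristic zero. [folklore] -/
instance : CharZero (GAlgCl p r hr) :=
  (RingHom.charZero_iff (algebraMap (GFunHat p r hr) (GAlgCl p r hr)).injective).mp inferInstance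

/-- `‖n‖ = |n|_p` in `GAlgCl`. [folklore] -/
theorem norm_natCast_GAlgCl (n : ℕ) : ‖(n : GAlgCl p r hr)‖ = ‖(n : ℚ_[p])‖ := by
  rw [← map_natCast (algebraMap (GFunHat p r hr) (GAlgCl p r hr)) n, norm_algebraMap_GAlgCl, norm_natCast_GFunHat]

/-- `ℚ_p ⊆ GAlgCl` is isometric. [folklore] -/
theorem norm_algebraMap_GAlgCl' (x : ℚ_[p]) : ‖algebraMap ℚ_[p] (GAlgCl p r hr) x‖ = ‖x‖ := by
  rw [IsScalarTower.algebraMap_apply ℚ_[p] (GFunHat p r hr) (GAlgCl p r hr), norm_algebraMap_GAlgCl,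
    norm_algebraMap_GFunHat]

/-- `GAlgCl` is a normed `ℚ_p`-algebra. [folklore] -/
instance : NormedAlgebra ℚ_[p] (GAlgCl p r hr) where
  norm_smul_le a x := by
    rw [Algebra.smul_def, norm_mul, norm_algebraMap_GAlgCl']

/-! ## 4. The completion: the Gauss untilt -/

/-- **The field of the Gauss untilt**: the completion of `GAlgCl`. [folklore] -/
abbrev GField : Type := UniformSpace.Completion (GAlgCl p r hr)

/-- `GField` is ultrametric. [folklore] -/
instance : IsUltrametricDist (GField p r hr) := isUltrametricDist_completion (GAlgCl p r hr)

/-- `GField` has characteristic zero. [folklore] -/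
instance : CharZero (GField p r hr) :=
  (RingHom.charZero_iff (algebraMap (GAlgCl p r hr) (GField p r hr)).injective).mp inferInstance

/-- `algebraMap GAlgCl GField` is the completion map. [folklore] -/
theorem algebraMap_GField_eq (x : GAlgCl p r hr) : algebraMap (GAlgCl p r hr) (GField p r hr) x = (x : GField p r hr) :=
  rfl

/-- The completion map preserves norms. [folklore] -/
theorem norm_coe_GField (x : GAlgCl p r hr) : ‖(x : GField p r hr)‖ = ‖x‖ := UniformSpace.Completion.norm_coe x

/-- `‖n‖ = |n|_p` in `GField`. [folklore] -/
theorem norm_natCast_GField (n : ℕ) : ‖(n : GField p r hr)‖ = ‖(n : ℚ_[p])‖ := by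
  rw [← map_natCast (algebraMap (GAlgCl p r hr) (GField p r hr)) n, algebraMap_GField_eq, norm_coe_GField,
    norm_natCast_GAlgCl]

/-- `GField` is nontrivially normed. [folklore] -/
instance : NontriviallyNormedField (GField p r hr) where
  non_trivial := ⟨((p : GField p r hr))⁻¹, by
    rw [norm_inv, norm_natCast_GField, Padic.norm_p]
    simp only [inv_inv, Nat.one_lt_cast]
    exact (Fact.out : p.Prime).one_lt⟩

/-- **`GField` is algebraically closed** — the completion of the algebraically closed `GAlgCl` (Mathlib
`IsAlgClosed.of_denseRange`, the theorem behind `PadicComplex.isAlgClosed`). [folklore] -/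
instance : IsAlgClosed (GField p r hr) :=
  IsAlgClosed.of_denseRange (K := GAlgCl p r hr) UniformSpace.Completion.denseRange_coe

/-- **THE GAUSS UNTILT of radius `r`**: `GField` is an untilt in E-t1's TYPED sense — a complete ultrametric normed
field, algebraically closed, of characteristic `0`, with `‖p‖ < 1` (E-t1's `Untilt p`, typing Joshi's «algebraically
closed perfectoid field» through [J-I] Lem. 3.2.1). CAVEAT (module docstring): NOT an untilt of `ℂ_p^♭` — E-t1's
carrier does not record the tilt ([J-I] v4 §3.6 p.10 l.10–13 «all untilts `K` will be assumed to be of this type»).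
[folklore] -/
def untilt : Untilt p where
  K := GField p r hr
  norm_p_lt_one := by
    rw [norm_natCast_GField, Padic.norm_p]
    exact inv_lt_one_of_one_lt₀ (by exact_mod_cast (Fact.out : p.Prime).one_lt)

/-- **`‖p‖ = p⁻¹`** in the Gauss untilt (the STANDARD normalisation — the same as `ℂ_p`'s). [folklore] -/
theorem norm_p_untilt : ‖(p : (untilt p r hr).K)‖ = (p : ℝ)⁻¹ := by
  show ‖(p : GField p r hr)‖ = _
  rw [norm_natCast_GField, Padic.norm_p]

/-- The variable `X` of `ℚ_p(X)` in `GFun`. [folklore] -/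
def gaussT₁ : GFun p r hr := WithAbs.toAbs (gaussAbs p r hr) (algebraMap ℚ_[p][X] (RatFunc ℚ_[p]) X)

/-- … in `GAlgCl`. [folklore] -/
def gaussT₃ : GAlgCl p r hr := algebraMap (GFunHat p r hr) (GAlgCl p r hr) (gaussT₁ p r hr : GFunHat p r hr)

/-- **The distinguished element `T`** of the Gauss untilt (the image of `X`). [folklore] -/
def gaussT : GField p r hr := (gaussT₃ p r hr : GField p r hr)

/-- **`‖T‖ = r`**: the value group of the Gauss untilt contains the radius. [folklore] -/
theorem norm_gaussT : ‖gaussT p r hr‖ = r := by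
  rw [gaussT, norm_coe_GField, gaussT₃, norm_algebraMap_GAlgCl, norm_coe_GFunHat, gaussT₁, WithAbs.norm_toAbs_eq,
    gaussAbs_X]

/-! ## 5. The preferred algebraic closure `Q̄_p ↪ 𝔾`: isometric and continuous -/

/-- `Q̄_p → GAlgCl`, a `ℚ_p`-algebra homomorphism into the algebraically closed stage. [folklore] -/
def liftAlgCl : AlgebraicClosure ℚ_[p] →ₐ[ℚ_[p]] GAlgCl p r hr := IsAlgClosed.lift

/-- **The preferred algebraic closure** `Q̄_p ↪ 𝔾` (E-t1's `UntiltPoints.algCl` datum for the sequel). [folklore] -/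
def algClGauss : AlgebraicClosure ℚ_[p] →+* GField p r hr :=
  (UniformSpace.Completion.coeRingHom (α := GAlgCl p r hr)).comp (liftAlgCl p r hr).toRingHom

/-- Unfolding `algClGauss`. [folklore] -/
theorem algClGauss_apply (x : AlgebraicClosure ℚ_[p]) :
    algClGauss p r hr x = ((liftAlgCl p r hr x : GAlgCl p r hr) : GField p r hr) := rfl

/-- The norm of `GAlgCl` pulled back to `Q̄_p` along the lift, as a `ℚ_p`-algebra norm. [folklore] -/
def pullbackAlgNorm : AlgebraNorm ℚ_[p] (AlgebraicClosure ℚ_[p]) where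
  toFun x := ‖liftAlgCl p r hr x‖
  map_zero' := by simp
  add_le' x y := by rw [map_add]; exact norm_add_le _ _
  neg' x := by rw [map_neg, norm_neg]
  mul_le' x y := by rw [map_mul, norm_mul]
  eq_zero_of_map_eq_zero' x hx := by
    have : liftAlgCl p r hr x = 0 := norm_eq_zero.mp hx
    exact (map_eq_zero_iff _ (liftAlgCl p r hr).toRingHom.injective).mp this
  smul' a x := by
    rw [Algebra.smul_def, map_mul, AlgHom.commutes, norm_mul, norm_algebraMap_GAlgCl']

/-- The pulled-back norm is power-multiplicative. [folklore] -/
theorem isPowMul_pullbackAlgNorm : IsPowMul (pullbackAlgNorm p r hr) := fun x n _ => by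
  show ‖liftAlgCl p r hr (x ^ n)‖ = ‖liftAlgCl p r hr x‖ ^ n
  rw [map_pow, norm_pow]

/-- **The lift `Q̄_p → GAlgCl` is ISOMETRIC** for the `p`-adic norm of `Q̄_p = PadicAlgCl p` (uniqueness of
power-multiplicative `ℚ_p`-algebra norms on algebraic extensions of the complete field `ℚ_p`, Mathlib
`spectralNorm_unique`). [folklore] -/
theorem norm_liftAlgCl (x : AlgebraicClosure ℚ_[p]) : ‖liftAlgCl p r hr x‖ = ‖x‖ := by
  rw [show ‖liftAlgCl p r hr x‖ = pullbackAlgNorm p r hr x from rfl,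
    spectralNorm_unique (isPowMul_pullbackAlgNorm p r hr)]
  rfl

/-- **`Q̄_p ↪ 𝔾` is isometric.** [folklore] -/
theorem norm_algClGauss (x : AlgebraicClosure ℚ_[p]) : ‖algClGauss p r hr x‖ = ‖x‖ := by
  rw [algClGauss_apply, norm_coe_GField, norm_liftAlgCl]

/-- `Q̄_p ↪ 𝔾` is continuous. [folklore] -/
theorem continuous_algClGauss : Continuous (algClGauss p r hr) :=
  AddMonoidHomClass.continuous_of_bound (algClGauss p r hr) 1 fun x => by rw [norm_algClGauss, one_mul]

/-- `ℚ_p ⊆ Q̄_p ↪ 𝔾` is continuous (E-t1's `UntiltPoints.continuous_algCl` / `ATSObj.continuous_emb` datum). [folklore] -/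
theorem continuous_algClGauss_padic :
    Continuous fun x : ℚ_[p] => algClGauss p r hr (algebraMap ℚ_[p] (AlgebraicClosure ℚ_[p]) x) :=
  (continuous_algClGauss p r hr).comp (continuous_algebraMap ℚ_[p] (PadicAlgCl p))

end Summit.ABC.IUTFork.Joshi.GaussUntilt

namespace Summit.ABC.IUTFork.Joshi.Untilt

/-- **`Untilt.gauss p r hr`** — the Gauss untilt of radius `r`, next to E-t1's `Untilt.padicComplex` and E-t17's
`Untilt.rescaled`: an inhabitant of `Untilt p` with `‖p‖ = p⁻¹` and an element of norm `r`. [folklore] -/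
abbrev gauss (p : ℕ) [Fact p.Prime] (r : ℝ) (hr : 0 < r) : Untilt p := GaussUntilt.untilt p r hr

/-- `‖p‖ = p⁻¹` in `Untilt.gauss p r hr`. [folklore] -/
theorem norm_p_gauss (p : ℕ) [Fact p.Prime] (r : ℝ) (hr : 0 < r) : ‖(p : (gauss p r hr).K)‖ = (p : ℝ)⁻¹ :=
  GaussUntilt.norm_p_untilt p r hr

/-- `Untilt.gauss p r hr` has an element of norm `r`. [folklore] -/
theorem exists_norm_eq_gauss (p : ℕ) [Fact p.Prime] (r : ℝ) (hr : 0 < r) : ∃ t : (gauss p r hr).K, ‖t‖ = r :=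
  ⟨GaussUntilt.gaussT p r hr, GaussUntilt.norm_gaussT p r hr⟩

end Summit.ABC.IUTFork.Joshi.Untilt

end
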